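import Literature.NumberTheory.Automorphic.UnitaryGroupUnipotentRationalBorelTwo
import Literature.NumberTheory.Automorphic.UnitaryGroupKernelClassUnipotent
import Literature.NumberTheory.Automorphic.UnitaryGroupArthurKernelClassExpansion
import Literature.NumberTheory.Automorphic.UnitaryGroupAdelicCenterRational
import HarnessLib

/-!
# The class kernel of `U(J₂)` at the central class `z · 𝒰(F)`:
# `K_𝔬(x,x) = f(z₁) + Σ_{δ ∈ B(F)∖G(F)} Σ_{u ∈ N(F), u ≠ 1} f(x⁻¹ δ⁻¹ z₁ u δ x)`
(Rogawski, *Automorphic Representations of Unitary Groups in Three Variables* (1990), §7.3 Prop. 7.3.1 (pp. 97–98): for `U(2)`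
«the unipotent term is treated as in the previous section»; here the POINTWISE identity behind its first bracket, the `N = 2`
twin of ★ `UnitaryGroupKernelClassUnipotent` (B0 FILE 3 of the `U(3)` LAW 5 road).)

Topic `NumberTheory/Automorphic`; namespace `Literature.NumberTheory.Automorphic.UnitaryGroup`. THEOREMS ONLY over accepted tree modules
(no definition, no named fact, no instance, no notation, no `sorry`). H-side row (σ-u) «`KernelClassUnipotentTwo`» of `CENSUS-LAWS-Hside`
(cell `pub/hodgecm-mathlib`, crux H413, `Cruxes/H413/Lines/F0_T1InnerFormTraceIdentity.lean`).

* §1 (EVERY `N`, names `_fin`): the rational central element `z₁ = toAdelic (z·1)` (`z ∈ E¹`, ★ `ratCenter`):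
  `charpoly_toAdelic_ratCenter_fin` (`charpoly z₁ = (X − z)^N ⊗ 𝔸_E`), `coe_adelicVal_toAdelic_ratCenter_fin`, `toAdelic_ratCenter_mul_comm_fin`
  (`z₁` central), `apply_self_eq_of_blockTriangular_of_charpoly_eq_fin`, `charpoly_mul_eq_of_mem_adelicUnipotent_fin` ∕
  `inv_mul_mem_adelicUnipotent_of_charpoly_eq_fin` (`B(F) ∩ 𝔬 = z₁ · N(F)`), `eq_of_coe_adelicVal_eq_smul_one_fin` — the letters the
  (σ-u) siblings (`KernelBorelClassUnipotentTwo`, `TruncatedKernelClassUnipotentTwo`) import.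
* §2 **`kernelClass_diag_eq_add_tsum_central_two`** — `K_𝔬(x, x) = f(z₁) + Σ'_{q : B(F)∖G(F)} Σ'_{u ∈ N(F), u ≠ 1}
  f(x⁻¹ q̃⁻¹ z₁ u q̃ x)` whenever the class sum is summable at `x`: the bijection `(B(F)δ, u) ↦ δ⁻¹ z₁ u δ` of
  `(B(F)∖G(F)) × (N(F) ∖ 1)` onto `𝔬 ∖ {z₁}` — surjective by ★ `forall_exists_conj_mem_arithmeticBorel_of_charpoly_eq_sq_two`, injective by ★
  `mem_arithmeticBorel_of_conj_mem_of_conj_mem_two` (p04's `UnitaryGroupUnipotentRationalBorelTwo`) — then Mathlib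
  `Summable.sum_add_tsum_subtype_compl`, `Equiv.tsum_eq`, `Summable.tsum_prod`. At `N = 2`, `N(F) ≅ E⁻` is the centre LINE (★ H-B1a
  `UnitaryGroupLineUnipotentTwo`), so the inner sum is the centre-line sum of [Rogawski1990, §7.3 p. 95] alone.

## References

* J. D. Rogawski, *Automorphic Representations of Unitary Groups in Three Variables*, Annals of Mathematics Studies 123 (1990), §2.2 (p. 13),
  Prop. 7.2.1 (pp. 91–92), §7.3 Prop. 7.3.1 (pp. 97–98) [Rogawski1990].
* J. Arthur, *A trace formula for reductive groups I*, Duke Math. J. 45 (1978), §8 [Arthur1978TraceFormulaI].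
-/

set_option autoImplicit false

noncomputable section

open NumberField IsDedekindDomain Matrix Polynomial MeasureTheory
open scoped MatrixGroups

namespace Literature.NumberTheory.Automorphic

namespace UnitaryGroup

variable {F E : Type} [Field F] [NumberField F] [Field E] [NumberField E] [Algebra F E]
  {c : E ≃ₐ[F] E} {ι : Type*}

section Fin

variable {N : ℕ} (ζ : ratOne F E c) {z₁ : (quasiSplit F E c N).arithmeticSubgroup}

omit [NumberField F] [NumberField E] in
/-- An upper triangular `N × N` matrix with `charpoly = (X − z)^N` has diagonal entries `z` (Mathlib
`Matrix.charpoly_of_upperTriangular`; the `N = 3` ∕ `N = 2` cases are ★ `apply_self_eq_of_blockTriangular_of_charpoly_eq` ∕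
`…_sq_two`). [cite: Rogawski1990, §1.9 (p. 9)] -/
theorem apply_self_eq_of_blockTriangular_of_charpoly_eq_fin {B : Matrix (Fin N) (Fin N) E}
    (hB : B.BlockTriangular id) {z : E} (hchar : B.charpoly = (X - C z) ^ N) (i : Fin N) : B i i = z := by
  have h := Matrix.charpoly_of_upperTriangular B hB
  rw [hchar] at h
  have h0 : ((X - C z) ^ N : E[X]).eval (B i i) = 0 := by
    rw [h, Polynomial.eval_prod]
    exact Finset.prod_eq_zero (Finset.mem_univ i) (by simp)
  simp only [eval_pow, eval_sub, eval_X, eval_C] at h0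
  have hN : N ≠ 0 := fun hN => by subst hN; exact Fin.elim0 i
  exact sub_eq_zero.1 ((pow_eq_zero_iff hN).1 h0)


/-! ## §1 The central element `z₁` and the Borel fibre `B(F) ∩ 𝔬 = z₁ · N(F)` -/

/-- **The rational central element `z·1` has `charpoly = (X − z)^N ⊗ 𝔸_E`** (`z ∈ E¹`; ★ `ratCenter`,
★ `charpoly_adelicVal_toAdelic`, Mathlib `Matrix.charpoly_of_upperTriangular`). [cite: Rogawski1990, §2.2 (p. 13)] -/
theorem charpoly_toAdelic_ratCenter_fin (ζ : ratOne F E c) :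
    ((adelicVal F E c N _ ((quasiSplit F E c N).toAdelic
        (ratCenter F E c N ((StdForm.antidiagonal N).over E) ζ)) : GL (Fin N) (AdeleRing (𝓞 E) E)) :
        Matrix (Fin N) (Fin N) (AdeleRing (𝓞 E) E)).charpoly =
      ((X - C ((ζ : Eˣ) : E)) ^ N).map (algebraMap E (AdeleRing (𝓞 E) E)) := by
  rw [charpoly_adelicVal_toAdelic]
  congr 1
  change (((ratCenter F E c N ((StdForm.antidiagonal N).over E) ζ : rational F E c N _) : GL (Fin N) E) :
    Matrix (Fin N) (Fin N) E).charpoly = _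
  rw [coe_ratCenter]
  have hB : (((ζ : Eˣ) : E) • (1 : Matrix (Fin N) (Fin N) E)).BlockTriangular id := by
    intro i j hij
    have hij' : i ≠ j := ne_of_gt hij
    simp [hij']
  rw [Matrix.charpoly_of_upperTriangular _ hB]
  simp only [Matrix.smul_apply, Matrix.one_apply_eq, smul_eq_mul, mul_one, Finset.prod_const, Finset.card_univ,
    Fintype.card_fin]

/-- The adelic matrix of `z₁ = toAdelic (z·1)` is the scalar matrix `z·1`. [cite: Rogawski1990, §2.2 (p. 13)] -/
theorem coe_adelicVal_toAdelic_ratCenter_fin (ζ : ratOne F E c) :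
    ((adelicVal F E c N _ ((quasiSplit F E c N).toAdelic
        (ratCenter F E c N ((StdForm.antidiagonal N).over E) ζ)) : GL (Fin N) (AdeleRing (𝓞 E) E)) :
        Matrix (Fin N) (Fin N) (AdeleRing (𝓞 E) E)) =
      algebraMap E (AdeleRing (𝓞 E) E) ((ζ : Eˣ) : E) • (1 : Matrix (Fin N) (Fin N) (AdeleRing (𝓞 E) E)) := by
  change (((ratCenter F E c N ((StdForm.antidiagonal N).over E) ζ : rational F E c N _) : GL (Fin N) E) :
    Matrix (Fin N) (Fin N) E).map (algebraMap E (AdeleRing (𝓞 E) E)) = _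
  rw [coe_ratCenter, Matrix.smul_one_eq_diagonal, Matrix.diagonal_map (map_zero _), Matrix.smul_one_eq_diagonal]

/-- **`z₁` is central in `G(𝔸_F)`**: `z₁ g = g z₁`. [cite: Rogawski1990, §2.2 (p. 13)] -/
theorem toAdelic_ratCenter_mul_comm_fin (ζ : ratOne F E c) (g : (quasiSplit F E c N).Adelic) :
    (quasiSplit F E c N).toAdelic (ratCenter F E c N ((StdForm.antidiagonal N).over E) ζ) * g =
      g * (quasiSplit F E c N).toAdelic (ratCenter F E c N ((StdForm.antidiagonal N).over E) ζ) := by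
  apply adelicVal_injective F E c N
  refine Units.ext ?_
  rw [map_mul, map_mul, Units.val_mul, Units.val_mul, coe_adelicVal_toAdelic_ratCenter_fin, Matrix.smul_mul,
    Matrix.mul_smul, Matrix.one_mul, Matrix.mul_one]


/-- `z₁ ∈ G(F)` commutes with every element of `G(F)`. [cite: Rogawski1990, §2.2 (p. 13)] -/
theorem mul_comm_of_coe_eq_toAdelic_ratCenter_fin
    (hz₁ : (z₁ : (quasiSplit F E c N).Adelic) =
      (quasiSplit F E c N).toAdelic (ratCenter F E c N ((StdForm.antidiagonal N).over E) ζ))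
    (γ : (quasiSplit F E c N).arithmeticSubgroup) : z₁ * γ = γ * z₁ := by
  refine Subtype.ext ?_
  show (z₁ : (quasiSplit F E c N).Adelic) * (γ : (quasiSplit F E c N).Adelic) =
    (γ : (quasiSplit F E c N).Adelic) * (z₁ : (quasiSplit F E c N).Adelic)
  rw [hz₁]
  exact toAdelic_ratCenter_mul_comm_fin ζ _

/-- `z₁ ∈ B(F)` (a diagonal element). [cite: Rogawski1990, §2.2 (p. 13)] -/
theorem mem_arithmeticBorel_of_coe_eq_toAdelic_ratCenter_fin
    (hz₁ : (z₁ : (quasiSplit F E c N).Adelic) =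
      (quasiSplit F E c N).toAdelic (ratCenter F E c N ((StdForm.antidiagonal N).over E) ζ)) :
    z₁ ∈ arithmeticBorel F E c N := by
  rw [mem_arithmeticBorel_iff, mem_borelAdelic_iff, hz₁, coe_adelicVal_toAdelic_ratCenter_fin]
  intro i j hij
  have hij' : i ≠ j := ne_of_gt hij
  simp [hij']

/-- `charpoly z₁ = (X − z)^N ⊗ 𝔸_E`. [cite: Rogawski1990, §2.2 (p. 13)] -/
theorem charpoly_of_coe_eq_toAdelic_ratCenter_fin
    (hz₁ : (z₁ : (quasiSplit F E c N).Adelic) =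
      (quasiSplit F E c N).toAdelic (ratCenter F E c N ((StdForm.antidiagonal N).over E) ζ)) :
    ((adelicVal F E c N _ (z₁ : (quasiSplit F E c N).Adelic) : GL (Fin N) (AdeleRing (𝓞 E) E)) :
        Matrix (Fin N) (Fin N) (AdeleRing (𝓞 E) E)).charpoly =
      ((X - C ((ζ : Eˣ) : E)) ^ N).map (algebraMap E (AdeleRing (𝓞 E) E)) := by
  rw [hz₁]; exact charpoly_toAdelic_ratCenter_fin ζ

/-- **`B(F) ∩ 𝔬 ⊇ z₁ · N(F)`**: for `u ∈ G(F) ∩ N(𝔸_F)`, `charpoly (z₁ u) = (X − z)^N ⊗ 𝔸_E`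
(★ `isUnipotentInvariantOnBorel_charpoly_adelicVal`; and `z₁ u ∈ B(F)`). [cite: Rogawski1990, Prop. 7.2.1 (pp. 91–92)] -/
theorem charpoly_mul_eq_of_mem_adelicUnipotent_fin
    (hz₁ : (z₁ : (quasiSplit F E c N).Adelic) =
      (quasiSplit F E c N).toAdelic (ratCenter F E c N ((StdForm.antidiagonal N).over E) ζ))
    {u : (quasiSplit F E c N).arithmeticSubgroup} (hu : (u : (quasiSplit F E c N).Adelic) ∈ adelicUnipotent F E c N) :
    ((adelicVal F E c N _ ((z₁ * u : (quasiSplit F E c N).arithmeticSubgroup) : (quasiSplit F E c N).Adelic) :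
        GL (Fin N) (AdeleRing (𝓞 E) E)) : Matrix (Fin N) (Fin N) (AdeleRing (𝓞 E) E)).charpoly =
      ((X - C ((ζ : Eˣ) : E)) ^ N).map (algebraMap E (AdeleRing (𝓞 E) E)) := by
  have h := isUnipotentInvariantOnBorel_charpoly_adelicVal _ _
    (mem_arithmeticBorel_of_coe_eq_toAdelic_ratCenter_fin ζ hz₁) hu
  dsimp only at h
  rw [h]
  exact charpoly_of_coe_eq_toAdelic_ratCenter_fin ζ hz₁

/-- **`B(F) ∩ 𝔬 ⊆ z₁ · N(F)`**: an element `β ∈ B(F)` with `charpoly β = (X − z)^N ⊗ 𝔸_E` has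
`z₁⁻¹ β ∈ N(𝔸_F)` (its rational matrix is upper triangular with diagonal `(z,z,z)`, ★
`apply_self_eq_of_blockTriangular_of_charpoly_eq`). [cite: Rogawski1990, Prop. 7.2.1 (pp. 91–92)] -/
theorem inv_mul_mem_adelicUnipotent_of_charpoly_eq_fin
    (hz₁ : (z₁ : (quasiSplit F E c N).Adelic) =
      (quasiSplit F E c N).toAdelic (ratCenter F E c N ((StdForm.antidiagonal N).over E) ζ))
    {β : (quasiSplit F E c N).arithmeticSubgroup} (hβ : β ∈ arithmeticBorel F E c N)
    (hchar : ((adelicVal F E c N _ (β : (quasiSplit F E c N).Adelic) : GL (Fin N) (AdeleRing (𝓞 E) E)) :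
        Matrix (Fin N) (Fin N) (AdeleRing (𝓞 E) E)).charpoly =
      ((X - C ((ζ : Eˣ) : E)) ^ N).map (algebraMap E (AdeleRing (𝓞 E) E))) :
    ((z₁⁻¹ * β : (quasiSplit F E c N).arithmeticSubgroup) : (quasiSplit F E c N).Adelic) ∈
      adelicUnipotent F E c N := by
  obtain ⟨β₀, hβ₀⟩ := β.2
  have hz0 : ((ζ : Eˣ) : E) ≠ 0 := (ζ : Eˣ).ne_zero
  have hB₀ : ((β₀.1 : GL (Fin N) E) : Matrix (Fin N) (Fin N) E).BlockTriangular id :=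
    (toAdelic_mem_borelAdelic_iff β₀).1 (by rw [hβ₀]; exact (mem_arithmeticBorel_iff β).1 hβ)
  have hdiag := apply_self_eq_of_blockTriangular_of_charpoly_eq_fin hB₀ (charpoly_eq_of_toAdelic_eq hβ₀ hchar)
  rw [mem_adelicUnipotent_iff, mem_upperUnitriangular_iff]
  -- the adelic matrix of `z₁⁻¹ β` is `(z⁻¹ β₀) ⊗ 𝔸_E`
  have hval : ((adelicVal F E c N _ ((z₁⁻¹ * β : (quasiSplit F E c N).arithmeticSubgroup) :
      (quasiSplit F E c N).Adelic) : GL (Fin N) (AdeleRing (𝓞 E) E)) : Matrix (Fin N) (Fin N) (AdeleRing (𝓞 E) E)) =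
      ((((ζ : Eˣ) : E)⁻¹ • ((β₀.1 : GL (Fin N) E) : Matrix (Fin N) (Fin N) E))).map
        (algebraMap E (AdeleRing (𝓞 E) E)) := by
    have h1 : ((z₁⁻¹ * β : (quasiSplit F E c N).arithmeticSubgroup) : (quasiSplit F E c N).Adelic) =
        (quasiSplit F E c N).toAdelic
          ((show (quasiSplit F E c N).Rational from ratCenter F E c N ((StdForm.antidiagonal N).over E) ζ)⁻¹ * β₀) := by
      rw [map_mul, map_inv, hβ₀, ← hz₁]; rfl
    rw [h1]
    change ((((show (quasiSplit F E c N).Rational from ratCenter F E c N ((StdForm.antidiagonal N).over E) ζ)⁻¹ * β₀ :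
      (quasiSplit F E c N).Rational).1 : GL (Fin N) E) : Matrix (Fin N) (Fin N) E).map (algebraMap E (AdeleRing (𝓞 E) E)) = _
    congr 1
    have hinv : ((show (quasiSplit F E c N).Rational from ratCenter F E c N ((StdForm.antidiagonal N).over E) ζ)⁻¹ :
        (quasiSplit F E c N).Rational) = ratCenter F E c N ((StdForm.antidiagonal N).over E) ζ⁻¹ :=
      (map_inv (ratCenter F E c N ((StdForm.antidiagonal N).over E)) ζ).symm
    rw [hinv]
    change (((ratCenter F E c N ((StdForm.antidiagonal N).over E) ζ⁻¹ : rational F E c N _) : GL (Fin N) E) :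
      Matrix (Fin N) (Fin N) E) * ((β₀.1 : GL (Fin N) E) : Matrix (Fin N) (Fin N) E) = _
    rw [coe_ratCenter, Matrix.smul_mul, Matrix.one_mul, Subgroup.coe_inv, Units.val_inv_eq_inv_val]
  rw [hval]
  refine ⟨fun i j hij => ?_, fun i => ?_⟩
  · rw [Matrix.map_apply, Matrix.smul_apply, hB₀ hij, smul_zero, map_zero]
  · rw [Matrix.map_apply, Matrix.smul_apply, hdiag, smul_eq_mul, inv_mul_cancel₀ hz0, map_one]

/-- `charpoly (δ⁻¹ γ δ) = charpoly γ` on `G(F)` (★ `isConjInvariant_charpoly_adelicVal`). [cite: Rogawski1990, §2.2 (p. 13)] -/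
theorem charpoly_adelicVal_inv_mul_mul_fin (γ δ : (quasiSplit F E c N).arithmeticSubgroup) :
    ((adelicVal F E c N _ ((δ⁻¹ * γ * δ : (quasiSplit F E c N).arithmeticSubgroup) : (quasiSplit F E c N).Adelic) :
        GL (Fin N) (AdeleRing (𝓞 E) E)) : Matrix (Fin N) (Fin N) (AdeleRing (𝓞 E) E)).charpoly =
      ((adelicVal F E c N _ (γ : (quasiSplit F E c N).Adelic) : GL (Fin N) (AdeleRing (𝓞 E) E)) :
        Matrix (Fin N) (Fin N) (AdeleRing (𝓞 E) E)).charpoly := by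
  exact (isConjInvariant_charpoly_adelicVal (F := F) (E := E) (c := c) (N := N)).apply_inv_mul_mul γ δ

/-- `charpoly (δ γ δ⁻¹) = charpoly γ` on `G(F)` (★ `isConjInvariant_charpoly_adelicVal`). [cite: Rogawski1990, §2.2 (p. 13)] -/
theorem charpoly_adelicVal_mul_mul_inv_fin (γ δ : (quasiSplit F E c N).arithmeticSubgroup) :
    ((adelicVal F E c N _ ((δ * γ * δ⁻¹ : (quasiSplit F E c N).arithmeticSubgroup) : (quasiSplit F E c N).Adelic) :
        GL (Fin N) (AdeleRing (𝓞 E) E)) : Matrix (Fin N) (Fin N) (AdeleRing (𝓞 E) E)).charpoly =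
      ((adelicVal F E c N _ (γ : (quasiSplit F E c N).Adelic) : GL (Fin N) (AdeleRing (𝓞 E) E)) :
        Matrix (Fin N) (Fin N) (AdeleRing (𝓞 E) E)).charpoly := by
  exact isConjInvariant_charpoly_adelicVal (F := F) (E := E) (c := c) (N := N) γ δ

/-- A non-central element of `G(F)`: if the adelic matrix of `γ` is the scalar `z·1` then `γ = z₁`.
[cite: Rogawski1990, §2.2 (p. 13)] -/
theorem eq_of_coe_adelicVal_eq_smul_one_fin
    (hz₁ : (z₁ : (quasiSplit F E c N).Adelic) =
      (quasiSplit F E c N).toAdelic (ratCenter F E c N ((StdForm.antidiagonal N).over E) ζ))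
    {γ : (quasiSplit F E c N).arithmeticSubgroup}
    (h : ((adelicVal F E c N _ (γ : (quasiSplit F E c N).Adelic) : GL (Fin N) (AdeleRing (𝓞 E) E)) :
        Matrix (Fin N) (Fin N) (AdeleRing (𝓞 E) E)) =
      algebraMap E (AdeleRing (𝓞 E) E) ((ζ : Eˣ) : E) • (1 : Matrix (Fin N) (Fin N) (AdeleRing (𝓞 E) E))) :
    γ = z₁ := by
  refine Subtype.ext (adelicVal_injective F E c N _ (Units.ext ?_))
  rw [h, hz₁, coe_adelicVal_toAdelic_ratCenter_fin]

end Fin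

section Two

variable (ζ : ratOne F E c) {z₁ : (quasiSplit F E c 2).arithmeticSubgroup}

/-! ## §2 `K_𝔬(x, x) = f(z₁) + Σ_{δ ∈ B(F)\G(F)} Σ_{u ∈ N(F), u ≠ 1} f(x⁻¹ δ⁻¹ z₁ u δ x)` -/

/-- **`K_𝔬(x, x) = f(z₁) + Σ_{δ ∈ B(F)\G(F)} Σ_{u ∈ N(F), u ≠ 1} f(x⁻¹ δ⁻¹ z₁ u δ x)` AT THE CENTRAL CLASS** (`z ∈ E¹`,
`z₁ = toAdelic (z·1)`; `δ = q̃ = Quotient.out q` the representative of the coset `q = B(F)δ`): for every class map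
`cl` whose fibre at `i` is `{γ : charpoly γ = (X − z)^2 ⊗ 𝔸_E}` and every `x` at which the class sum
`K_𝔬(x,x) = Σ'_{γ ∈ 𝔬} f(x⁻¹ γ x)` is summable, the class sum regroups along the BIJECTION
`(B(F)δ, u) ↦ δ⁻¹ z₁ u δ` of `(B(F)\G(F)) × (N(F) ∖ 1)` onto `𝔬 ∖ {z₁}` — surjective by ★
`forall_exists_conj_mem_arithmeticBorel_of_charpoly_eq_pow_three` (every element of the class lies in a rational
Borel; `B(F) ∩ 𝔬 = z₁ N(F)`), injective by ★ `mem_arithmeticBorel_of_conj_mem_of_conj_mem` (that Borel is unique).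
This is the pointwise form of «`J_G^T(𝔬,f)` is the sum of `m(𝐙G\𝐆)f(γ)` and `∫_{𝐙B\𝐆} [Σ_{u ∈ N, u ≠ 1} f(g⁻¹γug)
− …] dg`» [Rogawski1990, §7.3 p. 95] before the unfolding `∫_{G(F)\𝐆} Σ_{δ ∈ B(F)\G(F)} = ∫_{B(F)\𝐆}`.
[cite: Rogawski1990, §7.3 (p. 95)] [cite: Rogawski1990, Prop. 7.2.1 (pp. 91–92)] -/
theorem kernelClass_diag_eq_add_tsum_central_two {cl : (quasiSplit F E c 2).arithmeticSubgroup → ι}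
    (hz₁ : (z₁ : (quasiSplit F E c 2).Adelic) =
      (quasiSplit F E c 2).toAdelic (ratCenter F E c 2 ((StdForm.antidiagonal 2).over E) ζ))
    {i : ι} (hcl : ∀ γ : (quasiSplit F E c 2).arithmeticSubgroup, cl γ = i ↔
      ((adelicVal F E c 2 _ (γ : (quasiSplit F E c 2).Adelic) : GL (Fin 2) (AdeleRing (𝓞 E) E)) :
          Matrix (Fin 2) (Fin 2) (AdeleRing (𝓞 E) E)).charpoly =
        ((X - C ((ζ : Eˣ) : E)) ^ 2).map (algebraMap E (AdeleRing (𝓞 E) E)))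
    (f : (quasiSplit F E c 2).Adelic → ℂ) (x : (quasiSplit F E c 2).Adelic)
    (hsum : Summable fun γ : cl ⁻¹' {i} =>
      f (x⁻¹ * (((γ : cl ⁻¹' {i}) : (quasiSplit F E c 2).arithmeticSubgroup) : (quasiSplit F E c 2).Adelic) * x)) :
    kernelClass cl i f x x = f (z₁ : (quasiSplit F E c 2).Adelic) +
      ∑' q : Quotient (QuotientGroup.rightRel (arithmeticBorel F E c 2)),
        ∑' u : {u : rationalUnipotent F E c 2 // u ≠ 1},
          f (x⁻¹ * (((q.out⁻¹ * (z₁ * ⟨(((u.1 : rationalUnipotent F E c 2) : adelicUnipotent F E c 2) :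
              (quasiSplit F E c 2).Adelic), (u.1 : rationalUnipotent F E c 2).2⟩) * q.out :
            (quasiSplit F E c 2).arithmeticSubgroup)) : (quasiSplit F E c 2).Adelic) * x) := by
  classical
  have hz := conj_mul_self_of_ratOne ζ
  -- abbreviations (terms, not definitions)
  set Γq := Quotient (QuotientGroup.rightRel (arithmeticBorel F E c 2)) with hΓq
  set uG : {u : rationalUnipotent F E c 2 // u ≠ 1} → (quasiSplit F E c 2).arithmeticSubgroup := fun u =>
    ⟨(((u.1 : rationalUnipotent F E c 2) : adelicUnipotent F E c 2) : (quasiSplit F E c 2).Adelic),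
      (u.1 : rationalUnipotent F E c 2).2⟩ with huG
  have huGN : ∀ u, ((uG u : (quasiSplit F E c 2).arithmeticSubgroup) : (quasiSplit F E c 2).Adelic) ∈
      adelicUnipotent F E c 2 := fun u => ((u.1 : rationalUnipotent F E c 2) : adelicUnipotent F E c 2).2
  have huG1 : ∀ u, uG u ≠ 1 := by
    intro u h
    apply u.2
    have h' := congrArg (fun γ : (quasiSplit F E c 2).arithmeticSubgroup => (γ : (quasiSplit F E c 2).Adelic)) h
    exact Subtype.ext (Subtype.ext h')
  have hz₁i : cl z₁ = i := (hcl z₁).2 (charpoly_of_coe_eq_toAdelic_ratCenter_fin ζ hz₁)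
  have hz₁B := mem_arithmeticBorel_of_coe_eq_toAdelic_ratCenter_fin ζ hz₁
  -- the fibre point `z₁` and the map `Φ`
  set z₁' : ↥(cl ⁻¹' {i}) := ⟨z₁, hz₁i⟩ with hz₁'
  -- `γ(q,u) = q̃⁻¹ z₁ u q̃` lies in the class and is not `z₁`
  have hmem : ∀ (q : Γq) (u : {u : rationalUnipotent F E c 2 // u ≠ 1}),
      cl (q.out⁻¹ * (z₁ * uG u) * q.out) = i := fun q u => by
    rw [hcl, charpoly_adelicVal_inv_mul_mul_fin]
    exact charpoly_mul_eq_of_mem_adelicUnipotent_fin ζ hz₁ (huGN u)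
  have hne : ∀ (q : Γq) (u : {u : rationalUnipotent F E c 2 // u ≠ 1}),
      q.out⁻¹ * (z₁ * uG u) * q.out ≠ z₁ := by
    intro q u h
    apply huG1 u
    have h2 : z₁ * uG u = q.out * z₁ * q.out⁻¹ := by
      calc z₁ * uG u = q.out * (q.out⁻¹ * (z₁ * uG u) * q.out) * q.out⁻¹ := by group
        _ = q.out * z₁ * q.out⁻¹ := by rw [h]
    rw [← mul_comm_of_coe_eq_toAdelic_ratCenter_fin ζ hz₁ q.out, mul_assoc, mul_inv_cancel, mul_one] at h2
    exact mul_left_cancel (h2.trans (mul_one z₁).symm)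
  set Φ : Γq × {u : rationalUnipotent F E c 2 // u ≠ 1} →
      {t : ↥(cl ⁻¹' {i}) // t ∉ ({z₁'} : Finset ↥(cl ⁻¹' {i}))} := fun p =>
    ⟨⟨p.1.out⁻¹ * (z₁ * uG p.2) * p.1.out, hmem p.1 p.2⟩, by
      rw [Finset.mem_singleton]
      exact fun h => hne p.1 p.2 (congrArg Subtype.val h)⟩ with hΦ
  -- `Φ` is a bijection
  have hΦinj : Function.Injective Φ := by
    rintro ⟨q₁, u₁⟩ ⟨q₂, u₂⟩ h
    have hγ : q₁.out⁻¹ * (z₁ * uG u₁) * q₁.out = q₂.out⁻¹ * (z₁ * uG u₂) * q₂.out :=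
      congrArg (fun t => ((t.1 : ↥(cl ⁻¹' {i})) : (quasiSplit F E c 2).arithmeticSubgroup)) h
    set γ := q₁.out⁻¹ * (z₁ * uG u₁) * q₁.out with hγdef
    have h₁ : q₁.out * γ * q₁.out⁻¹ ∈ arithmeticBorel F E c 2 := by
      have : q₁.out * γ * q₁.out⁻¹ = z₁ * uG u₁ := by rw [hγdef]; group
      rw [this]
      exact mul_mem hz₁B (mem_arithmeticBorel_of_mem_adelicUnipotent (huGN u₁))
    have h₂ : q₂.out * γ * q₂.out⁻¹ ∈ arithmeticBorel F E c 2 := by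
      have : q₂.out * γ * q₂.out⁻¹ = z₁ * uG u₂ := by rw [hγ]; group
      rw [this]
      exact mul_mem hz₁B (mem_arithmeticBorel_of_mem_adelicUnipotent (huGN u₂))
    have hcharγ := (hcl γ).1 (hmem q₁ u₁)
    have hneγ : ((adelicVal F E c 2 _ (γ : (quasiSplit F E c 2).Adelic) : GL (Fin 2) (AdeleRing (𝓞 E) E)) :
        Matrix (Fin 2) (Fin 2) (AdeleRing (𝓞 E) E)) ≠
        algebraMap E (AdeleRing (𝓞 E) E) ((ζ : Eˣ) : E) • (1 : Matrix (Fin 2) (Fin 2) (AdeleRing (𝓞 E) E)) :=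
      fun h => hne q₁ u₁ (eq_of_coe_adelicVal_eq_smul_one_fin ζ hz₁ h)
    have hq : q₁ = q₂ := by
      rw [← Quotient.out_eq q₁, ← Quotient.out_eq q₂]
      exact Quotient.sound (QuotientGroup.rightRel_apply.2
        (mem_arithmeticBorel_of_conj_mem_of_conj_mem_two hcharγ hneγ h₁ h₂))
    subst hq
    have hu : uG u₁ = uG u₂ := by
      have h3 : z₁ * uG u₁ = z₁ * uG u₂ := by
        have := hγ
        rw [hγdef] at this
        simpa [mul_assoc] using this
      exact mul_left_cancel h3
    have hu' : u₁ = u₂ := by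
      have h' := congrArg (fun γ : (quasiSplit F E c 2).arithmeticSubgroup => (γ : (quasiSplit F E c 2).Adelic)) hu
      exact Subtype.ext (Subtype.ext (Subtype.ext h'))
    rw [hu']
  have hΦsurj : Function.Surjective Φ := by
    rintro ⟨⟨γ, hγi⟩, hγne⟩
    have hγne' : γ ≠ z₁ := by
      intro h; apply hγne; rw [Finset.mem_singleton]; exact Subtype.ext h
    have hcharγ := (hcl γ).1 hγi
    obtain ⟨δ, hδ⟩ := forall_exists_conj_mem_arithmeticBorel_of_charpoly_eq_sq_two hz γ hcharγ
    set q : Γq := Quotient.mk _ δ with hq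
    -- `q̃ δ⁻¹ ∈ B(F)`, so `β := q̃ γ q̃⁻¹ ∈ B(F)`
    have hrel : δ * q.out⁻¹ ∈ arithmeticBorel F E c 2 :=
      QuotientGroup.rightRel_apply.1 (Quotient.exact (by rw [hq, Quotient.out_eq]))
    set β := q.out * γ * q.out⁻¹ with hβ
    have hβB : β ∈ arithmeticBorel F E c 2 := by
      have : β = (δ * q.out⁻¹)⁻¹ * (δ * γ * δ⁻¹) * (δ * q.out⁻¹) := by rw [hβ]; group
      rw [this]
      exact mul_mem (mul_mem (inv_mem hrel) hδ) hrel
    have hcharβ : ((adelicVal F E c 2 _ (β : (quasiSplit F E c 2).Adelic) : GL (Fin 2) (AdeleRing (𝓞 E) E)) :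
        Matrix (Fin 2) (Fin 2) (AdeleRing (𝓞 E) E)).charpoly =
        ((X - C ((ζ : Eˣ) : E)) ^ 2).map (algebraMap E (AdeleRing (𝓞 E) E)) := by
      rw [hβ, charpoly_adelicVal_mul_mul_inv_fin]; exact hcharγ
    have huN := inv_mul_mem_adelicUnipotent_of_charpoly_eq_fin ζ hz₁ hβB hcharβ
    set u₀ : rationalUnipotent F E c 2 :=
      ⟨⟨((z₁⁻¹ * β : (quasiSplit F E c 2).arithmeticSubgroup) : (quasiSplit F E c 2).Adelic), huN⟩,
        (z₁⁻¹ * β : (quasiSplit F E c 2).arithmeticSubgroup).2⟩ with hu₀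
    have hu₀1 : u₀ ≠ 1 := by
      intro h
      apply hγne'
      have h' : ((z₁⁻¹ * β : (quasiSplit F E c 2).arithmeticSubgroup) : (quasiSplit F E c 2).Adelic) = 1 :=
        congrArg (fun v : rationalUnipotent F E c 2 => (((v : adelicUnipotent F E c 2)) : (quasiSplit F E c 2).Adelic)) h
      have h'' : z₁⁻¹ * β = 1 := Subtype.ext h'
      have hβz : β = z₁ := by
        rw [← mul_one z₁, ← h'']; group
      -- `γ = q̃⁻¹ β q̃ = q̃⁻¹ z₁ q̃ = z₁`
      have : γ = q.out⁻¹ * β * q.out := by rw [hβ]; group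
      rw [this, hβz, mul_assoc, mul_comm_of_coe_eq_toAdelic_ratCenter_fin ζ hz₁ q.out, inv_mul_cancel_left]
    refine ⟨(q, ⟨u₀, hu₀1⟩), Subtype.ext (Subtype.ext ?_)⟩
    change q.out⁻¹ * (z₁ * uG ⟨u₀, hu₀1⟩) * q.out = γ
    have : uG ⟨u₀, hu₀1⟩ = z₁⁻¹ * β := Subtype.ext rfl
    rw [this, mul_inv_cancel_left, hβ]
    group
  -- regrouping
  set Fx : ↥(cl ⁻¹' {i}) → ℂ := fun γ =>
    f (x⁻¹ * (((γ : cl ⁻¹' {i}) : (quasiSplit F E c 2).arithmeticSubgroup) : (quasiSplit F E c 2).Adelic) * x)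
    with hFx
  have hsplit := hsum.sum_add_tsum_subtype_compl {z₁'}
  rw [Finset.sum_singleton] at hsplit
  have hxz : Fx z₁' = f (z₁ : (quasiSplit F E c 2).Adelic) := by
    simp only [hFx, hz₁']
    rw [hz₁, ← toAdelic_ratCenter_mul_comm_fin ζ x⁻¹, mul_assoc, inv_mul_cancel, mul_one]
  rw [kernelClass_def, ← hsplit, hxz]
  congr 1
  rw [← (Equiv.ofBijective Φ ⟨hΦinj, hΦsurj⟩).tsum_eq, Summable.tsum_prod]
  · rfl
  · exact (((Finset.summable_compl_iff {z₁'}).2 hsum).comp_injective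
      (Equiv.ofBijective Φ ⟨hΦinj, hΦsurj⟩).injective)


end Two

end UnitaryGroup

end Literature.NumberTheory.Automorphic
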